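/-
Public-domain reproduction (cell pub-lg7, seat 5).  A structural bound `m_K(D) ≤ 1` for the truncated singular-series mean
of Heath-Brown–Puchta §4 (22) in the tree's normalisation, and the resulting UNCONDITIONAL form of the `K = 6` floor of the
direct route.  No new mathematics.  This file is NOT a route to Goldbach and claims no value of `K`; `K = 6` is NOT claimed —
on the contrary, the file records that the direct route CANNOT give `K = 6` on the certified constants.
-/
import Literature.NumberTheory.Sieve.GoldbachLinnikDirectMean

/-!
# Goldbach–Linnik by the direct route, VII: `m_K(D) ≤ 1` and the `K = 6` floor without a hypothesis on the mean

Topic `Literature/NumberTheory/Sieve`.  Sequel to `GoldbachLinnikDirectMean.lean` / `GoldbachLinnikDirectSeven.lean`.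
**NOT A ROUTE TO GOLDBACH; no value of `K` is claimed.**

`GoldbachLinnikDirectSeven.direct_six_criterion_unmet` recorded the `K = 6` floor of the direct route over a hypothesis
`m ≤ 1` on the singular-series mean ("structural: the mean value of `𝔖` is `2`").  Here that hypothesis is PROVED for the
quantity the frame actually uses, `mKD K D = C₀ Σ_{1≤d≤D} f₁(d) · minResCount d K / ξ(d)^K` (`GoldbachLinnikDirectMean`):

* `sum_range_resCount`: `Σ_{r mod d} resCount d K r = ξ(d)^K` (the residue classes partition `[1, ξ(d)]^K`), hence
  `mul_minResCount_le`: `d · minResCount d K ≤ ξ(d)^K` and `fq_mul_minResCount_div_le`: each term of `m_K(D)/C₀` is at most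
  `f₁(d)/d = g₁(d)` (the tree's `SingularSeriesMean.gq 1`);
* **`mKD_le_one : mKD K D ≤ 1`** for every `K`, `D`: `Σ_{d≤D} g₁(d) ≤ S₁ = Σ_d g₁(d)` (`sum_gq_le_sq`) and the tree's Euler
  product `C₀ · S₁ = 1` (`twinPrimeConst_mul_sq` at `q = 1`: `C₀ Σ_{d odd □-free} ∏_{p∣d} 1/(p(p−2)) = C₀ ∏_{p>2}(p−1)²/(p(p−2))
  = 1`);
* **`direct_six_criterion_unmet_mKD`**: for every `D`, `¬ (C λ⁴ < mKD 6 D)` whenever `C ≥ 3.1644` and `λ ≥ 0.789401` — the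
  closing inequality `hcrit : C λ^{K−2} < M` of the direct-route frame (`goldbach_linnik_with_of_direct_inputs`) FAILS at
  `K = 6` with `M = mKD 6 D` (the constant frame B supplies, `hm_of_mKD`) for every truncation `D`, on every variant of the
  cell's pair-sieve constant (`C ≥ 3.1644`, in-house floor; the published flat constants are larger) and the published
  large-deviation constant `λ = 0.789401`: `C λ⁴ ≥ 3.1644 · 0.789401⁴ ≥ 1.2288 > 1 ≥ mKD 6 D`.  With `mKD_seven_ge`
  (`GoldbachLinnikDirectCertified`: `mKD 7 105 ≥ 0.987`) this brackets the frame's constant: `0.987 ≤ m₇(105) ≤ 1`.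

So the direct route's `K = 6` floor is now a statement about the frame's OWN quantities with no free hypothesis on the mean:
it misses by `22.88 %` of the criterion (`3.1644 · 0.789401⁴ = 1.228802…`).  `K = 6` is NOT claimed; nothing here lowers the published `K = 8`.

## References

* D. R. Heath-Brown, J.-C. Puchta, *Integers represented as a sum of primes and powers of two*, Asian J. Math. 6 (2002)
  535–565 (arXiv:math/0201299): §4 (21)–(22). [HeathbrownPuchta2002]
* D. A. Goldston, A. I. Suriajaya, *Note on the Goldbach conjecture and Landau–Siegel zeros*, arXiv:2104.09407 (2021): §6
  (the Euler product `C₀ S_q`, as formalised in `SingularSeriesMultiplesMean`). [GoldstonSuriajaya2021]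
* J. Pintz, I. Z. Ruzsa, *On Linnik's approximation to Goldbach's problem. I*, Acta Arith. 109 (2003) 169–194:
  Theorem 3 (`λ = c₁ = 0.789401`). [PintzRuzsa2003]
-/

open Finset Filter

namespace Literature.NumberTheory.Sieve

namespace GoldbachLinnik

open SingularSeriesMean

/-- The residue classes partition the exponent tuples: `Σ_{r mod d} resCount d K r = ξ(d)^K`. [folklore] -/
theorem sum_range_resCount {d : ℕ} (hd : d ≠ 0) (K : ℕ) :
    ∑ r ∈ Finset.range d, resCount d K (r : ZMod d) = ord2 d ^ K := by
  have hmaps : ((expTuplesL (ord2 d) K : Finset (Fin K → ℕ)) : Set (Fin K → ℕ)).MapsTo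
      (fun ν : Fin K → ℕ => ((tupleSum ν : ℕ) : ZMod d)) ((Finset.range d).image fun r : ℕ => (r : ZMod d)) := by
    intro ν _
    rw [Finset.coe_image, Set.mem_image]
    refine ⟨tupleSum ν % d, ?_, by simp only [ZMod.natCast_mod]⟩
    rw [Finset.mem_coe, Finset.mem_range]
    exact Nat.mod_lt _ (Nat.pos_of_ne_zero hd)
  have hinj : Set.InjOn (fun r : ℕ => (r : ZMod d)) (Finset.range d : Set ℕ) := by
    intro x hx y hy hxy
    rw [Finset.mem_coe, Finset.mem_range] at hx hy
    have h := (ZMod.natCast_eq_natCast_iff' x y d).1 hxy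
    rwa [Nat.mod_eq_of_lt hx, Nat.mod_eq_of_lt hy] at h
  rw [← card_expTuplesL (ord2 d) K, Finset.card_eq_sum_card_fiberwise hmaps, Finset.sum_image hinj]
  rfl

/-- `d · min_r resCount d K r ≤ ξ(d)^K`. [folklore] -/
theorem mul_minResCount_le {d : ℕ} (hd : d ≠ 0) (K : ℕ) : d * minResCount d K ≤ ord2 d ^ K := by
  rw [← sum_range_resCount hd K]
  have h := Finset.card_nsmul_le_sum (Finset.range d) (fun r : ℕ => resCount d K (r : ZMod d)) (minResCount d K)
    (fun r _ => minResCount_le hd _)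
  simpa [Finset.card_range, smul_eq_mul] using h

/-- Each term of `m_K(D)/C₀` is at most `f₁(d)/d = g₁(d)`. [cite: HeathbrownPuchta2002, §4 (22)] -/
theorem fq_mul_minResCount_div_le {d : ℕ} (hd : d ≠ 0) (K : ℕ) :
    fq 1 d * ((minResCount d K : ℝ) / (ord2 d : ℝ) ^ K) ≤ gq 1 d := by
  rw [gq_apply, div_eq_mul_one_div (fq 1 d) (d : ℝ)]
  refine mul_le_mul_of_nonneg_left ?_ (fq_nonneg 1 d)
  have hdpos : (0 : ℝ) < d := by exact_mod_cast Nat.pos_of_ne_zero hd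
  rcases Nat.eq_zero_or_pos (ord2 d ^ K) with h0 | hpos
  · rw [show ((ord2 d : ℝ)) ^ K = 0 by exact_mod_cast h0, div_zero]
    positivity
  · have hposR : (0 : ℝ) < (ord2 d : ℝ) ^ K := by exact_mod_cast hpos
    rw [div_le_div_iff₀ hposR hdpos, one_mul]
    have h := mul_minResCount_le hd K
    rw [mul_comm] at h
    exact_mod_cast h

/-- **`m_K(D) ≤ 1`** for every `K` and every truncation `D` (`C₀ Σ_{d≤D} f₁(d)/d ≤ C₀ S₁ = 1`).
[cite: HeathbrownPuchta2002, §4 (22); GoldstonSuriajaya2021, §6] -/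
theorem mKD_le_one (K D : ℕ) : mKD K D ≤ 1 := by
  have hC : 0 < twinPrimeConst := twinPrimeConst_pos_holds
  have hI : Icc 1 D = Ioc 0 D := by
    ext d
    simp only [Finset.mem_Icc, Finset.mem_Ioc]
    omega
  have hsum : ∑ d ∈ Icc 1 D, fq 1 d * ((minResCount d K : ℝ) / (ord2 d : ℝ) ^ K) ≤ SingularSeriesMean.sq 1 :=
    calc ∑ d ∈ Icc 1 D, fq 1 d * ((minResCount d K : ℝ) / (ord2 d : ℝ) ^ K) ≤ ∑ d ∈ Icc 1 D, gq 1 d :=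
          Finset.sum_le_sum fun d hd =>
            fq_mul_minResCount_div_le (by have := (Finset.mem_Icc.1 hd).1; omega) K
      _ = ∑ d ∈ Ioc 0 D, gq 1 d := by rw [hI]
      _ ≤ SingularSeriesMean.sq 1 := sum_gq_le_sq 1 D
  have h1 : twinPrimeConst * SingularSeriesMean.sq 1 = 1 := by
    rw [twinPrimeConst_mul_sq one_ne_zero, Nat.primeFactors_one, Finset.filter_empty, Finset.prod_empty]
  calc mKD K D = twinPrimeConst * ∑ d ∈ Icc 1 D, fq 1 d * ((minResCount d K : ℝ) / (ord2 d : ℝ) ^ K) := rfl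
    _ ≤ twinPrimeConst * SingularSeriesMean.sq 1 := mul_le_mul_of_nonneg_left hsum hC.le
    _ = 1 := h1

/-- **The `K = 6` floor of the direct route, with no hypothesis on the mean**: for every truncation `D`, the frame's closing
inequality `C λ⁴ < mKD 6 D` FAILS whenever `C ≥ 3.1644` (every variant of the cell's pair-sieve constant; the published flat
constants are larger still) and `λ ≥ 0.789401` (Pintz–Ruzsa's published large-deviation constant):
`C λ⁴ ≥ 1.2288 > 1 ≥ mKD 6 D`.  `K = 6` is NOT obtained on this route; NOT a route to Goldbach.
[cite: HeathbrownPuchta2002, §6 with §4 (22); PintzRuzsa2003, Thm 3] -/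
theorem direct_six_criterion_unmet_mKD {C lam : ℝ} (D : ℕ) (hC : 3.1644 ≤ C) (hlam : 0.789401 ≤ lam) :
    ¬ C * lam ^ (6 - 2) < mKD 6 D :=
  direct_six_criterion_unmet (mKD_le_one 6 D) hC hlam

/-- The same floor read as thresholds on one lever at a time against the PROVED ceiling `mKD 6 D ≤ 1`: the direct route at
`K = 6` would need `λ < (1/3.1644)^{1/4} < 0.7498` at `C = 3.1644`, or `C < 1/0.789401⁴ < 2.5753` at `λ = 0.789401` — and even
then only `C λ⁴ < 1` would hold, while the criterion needs `C λ⁴ < mKD 6 D ≤ 1`.  Numbers only; nothing is claimed. [folklore] -/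
theorem direct_six_necessary {C lam : ℝ} (D : ℕ) (h : C * lam ^ (6 - 2) < mKD 6 D) :
    C * lam ^ 4 < 1 := by
  have h1 := mKD_le_one 6 D
  have h4 : C * lam ^ (6 - 2) = C * lam ^ 4 := by norm_num
  linarith [h4 ▸ h]

end GoldbachLinnik

end Literature.NumberTheory.Sieve
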